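import Mathlib
import Summits.MatrixMultiplication.MatrixMultiplication.Theorems.LevelGradedCohnUmansLevelOneGL2DesignsTangencyTransport

/-!
# Orbitwise transport, and coset unions of the non-split torus certified in `O(k·p)`
(stub `stub_tangencySets`, crux `LevelOneGL2Designs`, stmt-MatrixMultiplication-14080; wall-breaker axis 3/12)

`srs_of_orbitwise` generalises the transport lemma `srs_of_transitive` from one orbit to a union of
orbits: if invertible matrices preserving `T` move a set of representatives `R` onto all of `T`, and
every representative owns a private origin-avoiding line, then `T` is a tangency set of full size.

`srs_of_normCosets` (matrix form; the decidable-certificate form and the instances are in the sequel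
`…TangencyNormCosetsCert`) specialises it to the record-producing family of this seat's census: unions of
cosets of `μ_m < 𝔽_{p²}^×` acting on `AG(2,p) = 𝔽_{p²} = 𝔽_p[θ]/(θ² − ν)`.  Multiplication by
`z = z₀ + z₁θ` is the matrix `Q(z) = !![z₀, ν z₁; z₁, z₀]`; the coset union is parametrised as
`{Q(γ)^k *ᵥ r : k < m, r ∈ reps}` for a generator `γ` of `μ_m`; membership is TESTED through the
character `z ↦ Q(z)^m *ᵥ e₀` (constant on cosets), so each private line costs `p` evaluations of an
`m`-th matrix power — `O(k·p·log m)` kernel work for `k` cosets instead of `(k m)²` pair tests.  The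
size `k·m` is certified by injectivity (`γ` of exact order `m`, anisotropy of the norm form, distinct
character values of the representatives).
-/

set_option linter.dupNamespace false -- `MatrixMultiplication.MatrixMultiplication` (summit = problem, D-0017)

open Finset Matrix

namespace Summit.MatrixMultiplication.MatrixMultiplication.Theorems.LevelOneGL2Designs.FlagLine

section Orbitwise

variable {p : ℕ}

/-- **Orbitwise transport.**  Let `T ⊆ (ZMod p)²`, `R` a set of representatives each owning a
private origin-avoiding line `{y | y ⬝ᵥ ℓ r = 1}` (through `r`, meeting `T` in no other point), and
suppose every `x ∈ T` is `M r` for some `r ∈ R` and some invertible matrix `M` mapping `T` into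
itself.  Then `T` carries a normal-form strong representative system with exactly `#T` flags.
[elementary] -/
theorem srs_of_orbitwise (T R : Finset (Fin 2 → ZMod p)) (ℓ : (Fin 2 → ZMod p) → (Fin 2 → ZMod p))
    (hinc : ∀ r ∈ R, r ⬝ᵥ ℓ r = 1) (hpriv : ∀ r ∈ R, ∀ y ∈ T, y ⬝ᵥ ℓ r = 1 → y = r)
    (htrans : ∀ x ∈ T, ∃ r ∈ R, ∃ M : Matrix (Fin 2) (Fin 2) (ZMod p),
      IsUnit M.det ∧ M *ᵥ r = x ∧ ∀ y ∈ T, M *ᵥ y ∈ T) :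
    ∃ S : Finset ((Fin 2 → ZMod p) × (Fin 2 → ZMod p)),
      S.card = T.card ∧ ∀ f ∈ S, ∀ f' ∈ S, (dotProduct f.1 f'.2 = 1 ↔ f = f') := by
  classical
  choose! rep hrep M hM using htrans
  let Φ : (Fin 2 → ZMod p) → (Fin 2 → ZMod p) × (Fin 2 → ZMod p) :=
    fun x => (x, (M x)⁻¹.transpose *ᵥ ℓ (rep x))
  have hΦinj : Set.InjOn Φ T := fun x _ y _ h => congrArg Prod.fst h
  have hsurj : ∀ x' ∈ T, ∀ y ∈ T, ∃ z ∈ T, M x' *ᵥ z = y := by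
    intro x' hx' y hy
    have hmaps : Set.MapsTo (fun z => M x' *ᵥ z) T T := fun z hz => (hM x' hx').2.2 z hz
    have hinj : Set.InjOn (fun z => M x' *ᵥ z) T := by
      intro z _ w _ hzw
      have := congrArg (fun v => (M x')⁻¹ *ᵥ v) hzw
      simpa only [mulVec_mulVec, nonsing_inv_mul _ (hM x' hx').1, one_mulVec] using this
    obtain ⟨z, hz, hzy⟩ := (Finset.surjOn_of_injOn_of_card_le _ hmaps hinj le_rfl) hy
    exact ⟨z, hz, hzy⟩
  refine ⟨T.image Φ, card_image_of_injOn hΦinj, ?_⟩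
  intro f hf f' hf'
  rw [mem_image] at hf hf'
  obtain ⟨x, hx, rfl⟩ := hf
  obtain ⟨x', hx', rfl⟩ := hf'
  constructor
  · intro h1
    have h2 : ((M x')⁻¹ *ᵥ x) ⬝ᵥ ℓ (rep x') = 1 := by
      rw [← dotProduct_transpose_inv_mulVec]; exact h1
    obtain ⟨z, hz, hzx⟩ := hsurj x' hx' x hx
    have hz' : (M x')⁻¹ *ᵥ x = z := by
      rw [← hzx, mulVec_mulVec, nonsing_inv_mul _ (hM x' hx').1, one_mulVec]
    rw [hz'] at h2
    have hzr : z = rep x' := hpriv _ (hrep x' hx') z hz h2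
    have hxx' : x = x' := by rw [← hzx, hzr, (hM x' hx').2.1]
    subst hxx'
    rfl
  · intro h
    have hxx' : x = x' := congrArg Prod.fst h
    subst hxx'
    show x ⬝ᵥ ((M x)⁻¹.transpose *ᵥ ℓ (rep x)) = 1
    have hinv : (M x)⁻¹ *ᵥ x = rep x := by
      have e : (M x)⁻¹ *ᵥ (M x *ᵥ rep x) = rep x := by
        rw [mulVec_mulVec, nonsing_inv_mul _ (hM x hx).1, one_mulVec]
      rw [(hM x hx).2.1] at e
      exact e
    rw [dotProduct_transpose_inv_mulVec, hinv, hinc _ (hrep x hx)]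

end Orbitwise

section NormCosets

variable {p : ℕ} [Fact p.Prime]

/-- The regular representation of `𝔽_p[θ]/(θ² − ν)` on `(ZMod p)²`: multiplication by `z₀ + z₁θ`. -/
theorem quadMat_mul_quadMat (ν : ZMod p) (z w : Fin 2 → ZMod p) :
    !![z 0, ν * z 1; z 1, z 0] * !![w 0, ν * w 1; w 1, w 0] =
      !![z 0 * w 0 + ν * z 1 * w 1, ν * (z 0 * w 1 + z 1 * w 0);
         z 0 * w 1 + z 1 * w 0, z 0 * w 0 + ν * z 1 * w 1] := by
  ext i j; fin_cases i <;> fin_cases j <;> simp [Matrix.mul_apply, Fin.sum_univ_two] <;> ring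

/-- Matrices of the form `!![a, ν b; b, a]` ("quad matrices") commute. [elementary] -/
theorem quadMat_comm (ν : ZMod p) (z w : Fin 2 → ZMod p) :
    !![z 0, ν * z 1; z 1, z 0] * !![w 0, ν * w 1; w 1, w 0] =
      !![w 0, ν * w 1; w 1, w 0] * !![z 0, ν * z 1; z 1, z 0] := by
  rw [quadMat_mul_quadMat, quadMat_mul_quadMat]
  have h1 : z 0 * w 0 + ν * z 1 * w 1 = w 0 * z 0 + ν * w 1 * z 1 := by ring
  have h2 : z 0 * w 1 + z 1 * w 0 = w 0 * z 1 + w 1 * z 0 := by ring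
  rw [h1, h2]

/-- Predicate: a matrix is a quad matrix for `ν`. -/
theorem quadMat_pow_isQuad (ν : ZMod p) (z : Fin 2 → ZMod p) (k : ℕ) :
    ∃ w : Fin 2 → ZMod p, !![z 0, ν * z 1; z 1, z 0] ^ k = !![w 0, ν * w 1; w 1, w 0] := by
  induction k with
  | zero => exact ⟨![1, 0], by ext i j; fin_cases i <;> fin_cases j <;> simp⟩
  | succ k ih =>
    obtain ⟨w, hw⟩ := ih
    refine ⟨![w 0 * z 0 + ν * w 1 * z 1, w 0 * z 1 + w 1 * z 0], ?_⟩
    rw [pow_succ, hw, quadMat_mul_quadMat]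
    simp only [Matrix.cons_val_zero, Matrix.cons_val_one]

/-- A quad matrix is recovered from its first column: `Q *ᵥ e₀ = (a, b)`. [elementary] -/
theorem quadMat_mulVec_e0 (ν : ZMod p) (w : Fin 2 → ZMod p) :
    !![w 0, ν * w 1; w 1, w 0] *ᵥ ![1, 0] = w := by
  funext i; fin_cases i <;> simp [mulVec, dotProduct, Fin.sum_univ_two]

/-- The quad matrix of `Q(z) *ᵥ v` is `Q(z) * Q(v)`. [elementary] -/
theorem quadMat_of_mulVec (ν : ZMod p) (z v : Fin 2 → ZMod p) :
    !![(!![z 0, ν * z 1; z 1, z 0] *ᵥ v) 0, ν * (!![z 0, ν * z 1; z 1, z 0] *ᵥ v) 1;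
       (!![z 0, ν * z 1; z 1, z 0] *ᵥ v) 1, (!![z 0, ν * z 1; z 1, z 0] *ᵥ v) 0] =
      !![z 0, ν * z 1; z 1, z 0] * !![v 0, ν * v 1; v 1, v 0] := by
  rw [quadMat_mul_quadMat]
  have e0 : (!![z 0, ν * z 1; z 1, z 0] *ᵥ v) 0 = z 0 * v 0 + ν * z 1 * v 1 := by
    simp [mulVec, dotProduct, Fin.sum_univ_two]
  have e1 : (!![z 0, ν * z 1; z 1, z 0] *ᵥ v) 1 = z 0 * v 1 + z 1 * v 0 := by
    simp [mulVec, dotProduct, Fin.sum_univ_two]; ring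
  rw [e0, e1]

/-- Determinant of a quad matrix = the norm form. [elementary] -/
theorem det_quadMat (ν : ZMod p) (z : Fin 2 → ZMod p) :
    (!![z 0, ν * z 1; z 1, z 0]).det = z 0 * z 0 - ν * z 1 * z 1 := by
  rw [det_fin_two_of]

/-- **Coset unions of the non-split torus, certified in `O(k·p)`.**  Data: `ν` with anisotropic norm
form (`x² = ν y² ⇒ x = y = 0`), a vector `γ` whose quad matrix `G = Q(γ)` has `G^m = 1` and
`G^k ≠ 1` for `0 < k < m` (a generator of `μ_m`), representatives `reps : List` with pairwise distinct
character values `Q(r)^m *ᵥ e₀` and norms `≠ 0`, and for each representative a line `ℓ r` through it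
such that no point `y` of that line other than `r` has its character value among those of the
representatives.  Then the coset union `{G^k *ᵥ r}` is a tangency set with at least
`m · reps.length` flags. [elementary; `srs_of_orbitwise`] -/
theorem srs_of_normCosets (ν : ZMod p) (hν : ∀ x y : ZMod p, x * x = ν * (y * y) → x = 0 ∧ y = 0)
    (γ : Fin 2 → ZMod p) (m : ℕ) (hm : 0 < m)
    (hγm : !![γ 0, ν * γ 1; γ 1, γ 0] ^ m = 1)
    (hγk : ∀ k : ℕ, k < m → 0 < k → !![γ 0, ν * γ 1; γ 1, γ 0] ^ k ≠ 1)
    (reps : List (Fin 2 → ZMod p)) (hreps0 : ∀ r ∈ reps, r ≠ 0)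
    (hchars : reps.Pairwise fun r r' =>
      !![r 0, ν * r 1; r 1, r 0] ^ m *ᵥ ![1, 0] ≠ !![r' 0, ν * r' 1; r' 1, r' 0] ^ m *ᵥ ![1, 0])
    (ℓ : (Fin 2 → ZMod p) → (Fin 2 → ZMod p)) (hinc : ∀ r ∈ reps, r ⬝ᵥ ℓ r = 1)
    (hline : ∀ r ∈ reps, ∀ y : Fin 2 → ZMod p, y ⬝ᵥ ℓ r = 1 → y ≠ r →
      ∀ r' ∈ reps, !![y 0, ν * y 1; y 1, y 0] ^ m *ᵥ ![1, 0] ≠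
        !![r' 0, ν * r' 1; r' 1, r' 0] ^ m *ᵥ ![1, 0]) :
    ∃ S : Finset ((Fin 2 → ZMod p) × (Fin 2 → ZMod p)),
      m * reps.length ≤ S.card ∧ ∀ f ∈ S, ∀ f' ∈ S, (dotProduct f.1 f'.2 = 1 ↔ f = f') := by
  classical
  -- notation
  set G : Matrix (Fin 2) (Fin 2) (ZMod p) := !![γ 0, ν * γ 1; γ 1, γ 0] with hG
  let Q : (Fin 2 → ZMod p) → Matrix (Fin 2) (Fin 2) (ZMod p) := fun z => !![z 0, ν * z 1; z 1, z 0]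
  let χ : (Fin 2 → ZMod p) → (Fin 2 → ZMod p) := fun z => Q z ^ m *ᵥ ![1, 0]
  let R : Finset (Fin 2 → ZMod p) := reps.toFinset
  let pt : ℕ × (Fin 2 → ZMod p) → (Fin 2 → ZMod p) := fun kr => G ^ kr.1 *ᵥ kr.2
  let T : Finset (Fin 2 → ZMod p) := ((range m) ×ˢ R).image pt
  have hmemT : ∀ k r, k < m → r ∈ reps → pt (k, r) ∈ T := fun k r hk hr =>
    mem_image.mpr ⟨(k, r), mem_product.mpr ⟨mem_range.mpr hk, List.mem_toFinset.mpr hr⟩, rfl⟩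
  -- powers of G reduce mod m
  have hGmod : ∀ k : ℕ, G ^ (k % m) = G ^ k := by
    intro k
    conv_rhs => rw [← Nat.mod_add_div k m, pow_add, pow_mul, hγm, one_pow, mul_one]
  -- quad matrix of a point of the orbit, and the character is constant on cosets
  have hQpt : ∀ (k : ℕ) (r : Fin 2 → ZMod p), Q (G ^ k *ᵥ r) = G ^ k * Q r := by
    intro k r
    obtain ⟨w, hw⟩ := quadMat_pow_isQuad ν γ k
    show Q (G ^ k *ᵥ r) = G ^ k * Q r
    rw [hG, hw]
    exact quadMat_of_mulVec ν w r
  have hGQ_comm : ∀ (k : ℕ) (r : Fin 2 → ZMod p), G ^ k * Q r = Q r * G ^ k := by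
    intro k r
    obtain ⟨w, hw⟩ := quadMat_pow_isQuad ν γ k
    rw [hG, hw]
    exact quadMat_comm ν w r
  have hχ : ∀ (k : ℕ) (r : Fin 2 → ZMod p), χ (G ^ k *ᵥ r) = χ r := by
    intro k r
    show Q (G ^ k *ᵥ r) ^ m *ᵥ ![1, 0] = Q r ^ m *ᵥ ![1, 0]
    rw [hQpt, (Commute.eq (hGQ_comm k r) ▸ (Commute.mul_pow (hGQ_comm k r) m) :
      (G ^ k * Q r) ^ m = (G ^ k) ^ m * Q r ^ m), ← pow_mul, mul_comm k m, pow_mul, hγm, one_pow,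
      one_mul]
  -- private lines
  have hpriv : ∀ r ∈ R, ∀ y ∈ T, y ⬝ᵥ ℓ r = 1 → y = r := by
    intro r hr y hy hyl
    rw [List.mem_toFinset] at hr
    by_contra hne
    obtain ⟨⟨k, r'⟩, hkr, rfl⟩ := mem_image.mp hy
    rw [mem_product, mem_range, List.mem_toFinset] at hkr
    have h1 := hline r hr _ hyl hne r' hkr.2
    exact h1 (hχ k r')
  -- transitivity within cosets
  have hdetG : ∀ k : ℕ, IsUnit (G ^ k).det := by
    intro k
    rw [det_pow]
    refine IsUnit.pow _ (isUnit_iff_ne_zero.mpr ?_)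
    show (!![γ 0, ν * γ 1; γ 1, γ 0]).det ≠ 0
    rw [det_quadMat]
    intro h0
    have h0' : γ 0 * γ 0 = ν * (γ 1 * γ 1) := by linear_combination h0
    obtain ⟨hg0, hg1⟩ := hν _ _ h0'
    -- then G = 0, contradicting G ^ m = 1 with m > 0
    have hG0 : G = 0 := by
      rw [hG]; ext i j; fin_cases i <;> fin_cases j <;> simp [hg0, hg1]
    have : (G ^ m) = 0 := by rw [hG0, zero_pow (Nat.pos_iff_ne_zero.mp hm)]
    rw [hγm] at this
    exact one_ne_zero this
  have htrans : ∀ x ∈ T, ∃ r ∈ R, ∃ M : Matrix (Fin 2) (Fin 2) (ZMod p),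
      IsUnit M.det ∧ M *ᵥ r = x ∧ ∀ y ∈ T, M *ᵥ y ∈ T := by
    intro x hx
    obtain ⟨⟨k, r⟩, hkr, rfl⟩ := mem_image.mp hx
    rw [mem_product, mem_range] at hkr
    refine ⟨r, hkr.2, G ^ k, hdetG k, rfl, ?_⟩
    intro y hy
    obtain ⟨⟨k', r'⟩, hkr', rfl⟩ := mem_image.mp hy
    rw [mem_product, mem_range, List.mem_toFinset] at hkr'
    have : G ^ k *ᵥ pt (k', r') = pt ((k + k') % m, r') := by
      show G ^ k *ᵥ (G ^ k' *ᵥ r') = G ^ ((k + k') % m) *ᵥ r'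
      rw [mulVec_mulVec, ← pow_add, hGmod]
    rw [this]
    exact hmemT _ _ (Nat.mod_lt _ hm) hkr'.2
  have hincR : ∀ r ∈ R, r ⬝ᵥ ℓ r = 1 := fun r hr => hinc r (List.mem_toFinset.mp hr)
  obtain ⟨S, hS, hsrs⟩ := srs_of_orbitwise T R ℓ hincR hpriv htrans
  refine ⟨S, ?_, hsrs⟩
  rw [hS]
  -- size: pt is injective on range m × R
  have hnodup : reps.Nodup := by
    refine List.Pairwise.imp_of_mem ?_ hchars
    intro a b _ _ h hab
    exact h (hab ▸ rfl)
  -- no zero divisors among quad matrices acting on non-zero vectors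
  have hcancel : ∀ (w r : Fin 2 → ZMod p), r ≠ 0 → Q w *ᵥ r = r → Q w = 1 := by
    intro w r hr h
    -- (Q w - 1) r = 0 with r ≠ 0 forces det (Q w - 1) = 0, i.e. norm of (w - 1) = 0, so w = (1,0)
    have h2 : (Q w - 1) *ᵥ r = 0 := by rw [sub_mulVec, one_mulVec, h, sub_self]
    have hdet : (Q w - 1).det = 0 := by
      by_contra hd
      have hu : IsUnit (Q w - 1).det := isUnit_iff_ne_zero.mpr hd
      have := congrArg (fun v => (Q w - 1)⁻¹ *ᵥ v) h2
      simp only [mulVec_mulVec, nonsing_inv_mul _ hu, one_mulVec, mulVec_zero] at this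
      exact hr this
    have hQ1 : Q w - 1 = !![w 0 - 1, ν * w 1; w 1, w 0 - 1] := by
      ext i j; fin_cases i <;> fin_cases j <;> simp [Q]
    rw [hQ1, det_fin_two_of] at hdet
    have h3 : (w 0 - 1) * (w 0 - 1) = ν * (w 1 * w 1) := by linear_combination hdet
    obtain ⟨h4, h5⟩ := hν _ _ h3
    have hw0 : w 0 = 1 := by linear_combination h4
    show Q w = 1
    ext i j; fin_cases i <;> fin_cases j <;> simp [Q, hw0, h5]
  have hinj : Set.InjOn pt ((range m) ×ˢ R : Finset (ℕ × (Fin 2 → ZMod p))) := by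
    rintro ⟨k, r⟩ hkr ⟨k', r'⟩ hkr' h
    simp only [coe_product, coe_range, Set.mem_prod, Set.mem_Iio, mem_coe, List.mem_toFinset,
      R] at hkr hkr'
    change G ^ k *ᵥ r = G ^ k' *ᵥ r' at h
    -- same character value forces r = r'
    have hrr : r = r' := by
      by_contra hne
      have hc := congrArg χ h
      rw [hχ, hχ] at hc
      haveI hsym : Std.Symm (fun a b : Fin 2 → ZMod p => χ a ≠ χ b) := ⟨fun a b hab hba => hab hba.symm⟩
      have hchars' : reps.Pairwise (fun a b : Fin 2 → ZMod p => χ a ≠ χ b) := hchars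
      exact List.Pairwise.forall hchars' hkr.2 hkr'.2 hne hc
    subst hrr
    -- then G^k r = G^k' r forces G^(k-k') = 1, so k = k'
    have hkk : k = k' := by
      by_contra hne
      wlog hlt : k' < k generalizing k k'
      · exact this k' k hkr' hkr h.symm (Ne.symm hne) (lt_of_le_of_ne (not_lt.mp hlt) hne)
      obtain ⟨d, rfl⟩ := Nat.exists_eq_add_of_lt hlt
      have h2 : G ^ (d + 1) *ᵥ r = r := by
        have e : G ^ (k' + d + 1) = G ^ k' * G ^ (d + 1) := by rw [add_assoc, pow_add]
        rw [e, ← mulVec_mulVec] at h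
        have := congrArg (fun v => (G ^ k')⁻¹ *ᵥ v) h
        simpa only [mulVec_mulVec, ← Matrix.mul_assoc, nonsing_inv_mul _ (hdetG k'), Matrix.one_mul,
          one_mulVec] using this
      obtain ⟨w, hw⟩ := quadMat_pow_isQuad ν γ (d + 1)
      have hw' : G ^ (d + 1) = Q w := by rw [hG]; exact hw
      rw [hw'] at h2
      have h3 := hcancel w r (hreps0 r hkr.2) h2
      rw [← hw'] at h3
      exact hγk (d + 1) (by omega) (by omega) h3
    subst hkk
    rfl
  calc m * reps.length = #(range m ×ˢ R) := by
        rw [card_product, card_range, List.toFinset_card_of_nodup hnodup]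
    _ = #(((range m) ×ˢ R).image pt) := (card_image_of_injOn hinj).symm
    _ ≤ #T := le_rfl

end NormCosets

end Summit.MatrixMultiplication.MatrixMultiplication.Theorems.LevelOneGL2Designs.FlagLine
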